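import Summits.MatrixMultiplication.MatrixMultiplication.Theorems.AbelianSTPPCensusTAStatDefs
import Summits.MatrixMultiplication.MatrixMultiplication.Theorems.AbelianSTPPCensusTAStatCData

/-!
# T_A certificate, third range `5667 … 6190`: the static t*-indexed linear checker with a free budget parameter, universe `6190` (definitions)

Cell mm-stpp (rung F-M1), threshold T_A = `τ = 2.371`.  The data-dependent part of `AbelianSTPPCensusTAStatDefs.lean` (design there) at the
universe `Mtop = 6190`, orders `lo = 5667 … 6190`, over the table `TAStatCData.E` (92 levels × 74 buckets), with ONE change: the
Grynkiewicz budget of bucket `j` (and the U11-G densities `gW/wW`) are taken at the parameter `tp j = TP[j] ≤ TB[j]` instead of `TB[j]`; the data-free parts of the checker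
(`TAStat.tm`, `e0`, `domP`, `leP`, `leW`, `vpI`, `p1I`, `p2I`, `p3I`, `piece`, `pcs`, `vpCand`, `vpThresh`, `cover`) are reused by name.  Exact integer twin:
calc/tastat2/tastat2.py (theory g12; kit j287404 + seat runs out6190 (Mtop 6190: all 1 803 547 (shape, bucket) checks pass)).  With the old parameter `TB[j]` the relaxation first fails at `5675`; with `TP[j]` it passes to `6190`.
WHAT THIS IS NOT: no statement about STPP families or `ω` — arithmetic on shape lists only; nothing about orders `> 6190` or `< 5667`.
-/

set_option linter.dupNamespace false
set_option autoImplicit false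

namespace Summit.MatrixMultiplication.MatrixMultiplication.Theorems.TAStatC

open TECert (tableOK vol us)
open ShapeCert (gainOf2371i D)
open TAStatCData (E VL TB TP)
open TAStat (tm Entry e0 domP leP leW vpI p1I p2I p3I piece pcs vpCand vpThresh cover)

/-! ## Parameters -/

/-- Largest order of the certificate (= the order of the single-member table defining the candidate shapes). -/
def Mtop : ℕ := 6190
/-- Least order of this range (orders `≤ 5000`: `noAbelianSTPPHostUpTo_2371_5000`). -/
def lo : ℕ := 5667
/-- Number of sub-intervals of orders on which the vM bound is re-checked by endpoint evaluation when one interval does not suffice. -/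
def J : ℕ := 12

/-! ## Candidate shapes (sorted), levels and buckets -/

/-- The sorted candidate shapes `(a, b, c)`, `a ≤ b ≤ c`, of volume exactly `V`, passing `TECert.tableOK` at order `Mtop`
(`a ≤ 18`, `b ≤ 78` suffice since `19³ = 6859 > Mtop` and `79² = 6241 > Mtop`). -/
def triplesS (V : ℕ) : List (ℕ × ℕ × ℕ) :=
  (List.range 18).flatMap fun a' =>
    if V % (a' + 1) = 0 then
      (List.range 78).filterMap fun b' =>
        if a' ≤ b' ∧ V / (a' + 1) % (b' + 1) = 0 ∧ b' + 1 ≤ V / (a' + 1) / (b' + 1) ∧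
            tableOK Mtop (a' + 1) (b' + 1) (V / (a' + 1) / (b' + 1)) = true then
          some (a' + 1, b' + 1, V / (a' + 1) / (b' + 1))
        else none
    else []

/-- level of a volume: the first index `i` with `V ≤ VL[i]` (`VL.length` if none). -/
def levOf (V : ℕ) : ℕ := VL.findIdx fun vl => decide (V ≤ vl)

/-- bucket of a parameter `t ≥ 1`: the last index `j` with `TB[j] ≤ t` (computed as (first index with `t < TB[j]`) − 1). -/
def bucketOf (t : ℕ) : ℕ := (TB.findIdx fun b => decide (t < b)) - 1

/-- lower end `TB[j]` of bucket `j` (default `0`) -/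
def tb (j : ℕ) : ℕ := TB.getD j 0

/-- budget parameter `TP[j]` of bucket `j` (default `0`); `TP[j] ≤ TB[j]`, and `TP[j] = TB[j]` or `19 ≤ TP[j]` (checked in `monoOK`) -/
def tp (j : ℕ) : ℕ := TP.getD j 0

/-! ## The table entries -/

/-- entry `(i, j)` of the table -/
def ent (i j : ℕ) : Entry := (E.getD i []).getD j e0

/-- U11-G domination of a shape (gain `g`, volume `V`, pair-product sum `p`) along a table row from bucket `j` on, each entry read at its own bucket
budget parameter `t = TP[j]`: `V < t·p` and `g·wW ≤ gW·(t·p − V)`. -/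
def domWrow (g V p : ℕ) : List Entry → ℕ → Bool
  | [], _ => true
  | e :: es, j => Nat.blt V (tp j * p) && Nat.ble (g * e.2.2.2) (e.2.2.1 * (tp j * p - V)) && domWrow g V p es (j + 1)

/-- domination of one sorted candidate shape `x` of volume `V` (gain `g`): vM at its own (level, bucket), U11-G at its own level and every bucket
from its own on. -/
def domX (V g : ℕ) (x : ℕ × ℕ × ℕ) : Bool :=
  domP g (us x) ((E.getD (levOf V) []).getD (bucketOf (tm x)) e0) &&
    domWrow g V (us x) ((E.getD (levOf V) []).drop (bucketOf (tm x))) (bucketOf (tm x))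

/-- every sorted candidate shape of the volumes `V, …, V + n − 1` is dominated (`domX`) -/
def domV : ℕ → ℕ → Bool
  | 0, _ => true
  | n + 1, V => (triplesS V).all (domX V (gainOf2371i V)) && domV n (V + 1)

/-- Structural facts about the data, all checked by evaluation: every row has `nb` entries; all denominators are positive; the vM fraction is
monotone in the level and in the bucket, the U11-G fraction is monotone in the level; `TB[0] = 1`, `TB` is increasing with `TB[j+1] ≤ 2·TB[j]`
and (`TB[j] ≤ 1` or `TB[j+1] ≤ TB[j]²`); `TP[j] = TB[j]` or `19 ≤ TP[j]`, and `TP[j] ≤ TB[j]`. -/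
def monoOK (nl nb : ℕ) : Bool :=
  Nat.beq (tb 0) 1 &&
  (List.range nl).all (fun i => Nat.beq (E.getD i []).length nb &&
    (List.range nb).all (fun j =>
      Nat.ble 1 (ent i j).2.1 && Nat.ble 1 (ent i j).2.2.2 &&
      (Nat.ble (nl - 1) i || (leP (ent i j) (ent (i + 1) j) && leW (ent i j) (ent (i + 1) j))) &&
      (Nat.ble (nb - 1) j || leP (ent i j) (ent i (j + 1))))) &&
  (List.range nb).all (fun j => Nat.blt (tb j) (tb (j + 1)) && Nat.ble (tb (j + 1)) (2 * tb j) &&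
    (Nat.ble (tb j) 1 || Nat.ble (tb (j + 1)) (tb j * tb j)) &&
    (Nat.beq (tp j) (tb j) || Nat.ble 19 (tp j)) && Nat.ble (tp j) (tb j))

/-! ## The checks (data-free parts reused from `TAStat`) -/

/-- Walk the buckets `j, j+1, …` of a table row (the row dropped to index `j`) while `TB[j]³ ≤ V²`, checking `cover` at the budget parameter `t = TP[j]`. -/
def walk (g p V d L H : ℕ) : List Entry → ℕ → Bool
  | [], _ => true
  | e :: es, j => Nat.blt (V * V) (tb j * tb j * tb j) || (cover g p V d (tp j) L H e && walk g p V d L H es (j + 1))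

/-- The check of one sorted candidate shape `x` of volume `V` (gain `g`) as the maximal-volume member, for all orders `max(lo, V+1) … Mtop` and all
buckets from that of `x.1·x.2.1` on. -/
def checkShape (V g : ℕ) (x : ℕ × ℕ × ℕ) : Bool :=
  Nat.blt Mtop (max lo (V + 1)) ||
    walk g (us x) V (2 * us x - (x.1 + x.2.1 + x.2.2)) (max lo (V + 1)) Mtop
      ((E.getD (levOf V) []).drop (bucketOf (x.1 * x.2.1))) (bucketOf (x.1 * x.2.1))

/-- every sorted candidate shape of the volumes `V, …, V + n − 1` passes `checkShape` -/
def checkV : ℕ → ℕ → Bool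
  | 0, _ => true
  | n + 1, V => (triplesS V).all (checkShape V (gainOf2371i V)) && checkV n (V + 1)

/-! ## Specification vocabulary of the soundness proof (checker-internal predicates, no claims) -/

/-- Sorted candidate shapes: `1 ≤ a ≤ b ≤ c` and the single-member table at order `Mtop`. [bookkeeping] -/
def SCand (x : ℕ × ℕ × ℕ) : Prop :=
  1 ≤ x.1 ∧ x.1 ≤ x.2.1 ∧ x.2.1 ≤ x.2.2 ∧ tableOK Mtop x.1 x.2.1 x.2.2 = true

end Summit.MatrixMultiplication.MatrixMultiplication.Theorems.TAStatC
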